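import Mathlib
import Literature.Probability.LatticeModels.BrillouinRiemannSumAllSides

/-!
# Multi-loop momentum sums on the torus: product grids as one grid, and momentum conservation mod `2π`

Topic `Probability/LatticeModels`; companion of `BrillouinRiemannSum*.lean`.  A two-loop momentum sum
of finite-volume lattice perturbation theory on the `L^d` torus,
`L^{-d} Σ_p L^{-d} Σ_q F(2πp/L, 2πq/L, 2π(k + q - p)/L)`, is (a) a Riemann sum over the momentum grid
of the `2d`-dimensional torus — so the one-grid convergence theorems apply verbatim in dimension
`d₁ + d₂` — and (b) evaluates its third propagator at the lattice momentum of the torus site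
`k + q - p`, which agrees with `2πk/L + 2πq/L - 2πp/L` up to a vector of `2πℤ^d` (momentum
conservation on the discrete dual torus), invisible to `2π`-periodic symbols.  PROVED here:

* `sum_sum_eq_sum_torusSite_add` — `Σ_{p ∈ (ℤ/Lℤ)^{d₁}} Σ_{q ∈ (ℤ/Lℤ)^{d₂}} f(p, q) =
  Σ_{r ∈ (ℤ/Lℤ)^{d₁+d₂}} f(r ∘ castAdd, r ∘ natAdd)` (`Fin.appendEquiv`);
  `latticeMomentum_comp_castAdd` / `_natAdd` — the lattice momentum of `r` splits accordingly;
  `momentumAverage_momentumAverage_eq` — **the iterated momentum average is ONE momentum average in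
  dimension `d₁ + d₂`**;
* `doubleMomentumAverage_uniform_approx_allSides` — hence, for `G(x, y, z)` jointly continuous on
  `[0,2π]^{d₁} × [0,2π]^{d₂} × C` (`C` compact): the iterated averages
  `L^{-d₁} Σ_p L^{-d₂} Σ_q G(2πp/L, 2πq/L, z)` are within `ε` of
  `(2π)^{-(d₁+d₂)} ∫_{[-π,π]^{d₁+d₂}} G(w_I + π, w_II + π, z) dw` for ALL `L ≥ L₀`, uniformly in `z ∈ C`
  (`BrillouinRiemannSumAllSides.momentumAverage_uniform_approx_allSides` in dimension `d₁ + d₂`);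
* `exists_latticeMomentum_intCast_eq`, `exists_latticeMomentum_add_sub_eq` — **momentum conservation
  mod `2π`**: `p_{k+q-p} = p_k + p_q - p_p + 2πm` for some `m ∈ ℤ^d`; `apply_latticeMomentum_add_sub`
  — a `2π`-periodic symbol does not see `m`.

Everything is proved; no definitions.

## References

* S. Friedli, Y. Velenik, *Statistical Mechanics of Lattice Systems* (CUP 2017), §10.5.2 (the
  reciprocal torus `𝕋*_L` as the dual group; momentum sums as Riemann sums, (10.41)).
  [FriedliVelenikSMLS2017]
* G. Benfatto, A. Giuliani, V. Mastropietro, Ann. Henri Poincaré 7 (2006) 809–898, §2.1 (2.3)–(2.8)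
  (finite-volume perturbation theory on the space-time torus, momentum conservation at the vertices,
  limits `L → ∞` of the loop sums). [BenfattoGiulianiMastropietro2006]
-/

noncomputable section

namespace Literature.Probability.LatticeModels

open MeasureTheory Finset Real

variable {d d₁ d₂ : ℕ} {E : Type*} [NormedAddCommGroup E] [NormedSpace ℝ E] [CompleteSpace E]
  {Y : Type*} [PseudoMetricSpace Y]

/-! ### The product of two momentum grids is the momentum grid in dimension `d₁ + d₂` -/

omit [NormedSpace ℝ E] [CompleteSpace E] in
/-- **Iterated sum over two torus grids = one sum over the grid in dimension `d₁ + d₂`**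
(`Fin.appendEquiv`): `Σ_p Σ_q f(p, q) = Σ_r f(r ∘ castAdd, r ∘ natAdd)`.
[cite: FriedliVelenikSMLS2017, §10.5.2 (10.41)] -/
theorem sum_sum_eq_sum_torusSite_add {L : ℕ} [NeZero L] (f : TorusSite d₁ L → TorusSite d₂ L → E) :
    ∑ p : TorusSite d₁ L, ∑ q : TorusSite d₂ L, f p q =
      ∑ r : TorusSite (d₁ + d₂) L, f (fun i => r (Fin.castAdd d₂ i)) (fun j => r (Fin.natAdd d₁ j)) := by
  rw [← Fintype.sum_prod_type']
  refine Fintype.sum_equiv (Fin.appendEquiv d₁ d₂) _ _ fun x => ?_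
  simp only [Fin.appendEquiv_apply, Fin.append_left, Fin.append_right]

/-- The lattice momentum of `r ∈ (ℤ/Lℤ)^{d₁+d₂}` restricted to the first block is the lattice momentum
of the first block (coordinatewise definition). [cite: FriedliVelenikSMLS2017, §10.5.2 (10.41)] -/
theorem latticeMomentum_comp_castAdd {L : ℕ} (r : TorusSite (d₁ + d₂) L) :
    latticeMomentum L (fun i => r (Fin.castAdd d₂ i)) = fun i => latticeMomentum L r (Fin.castAdd d₂ i) :=
  rfl

/-- The lattice momentum of `r ∈ (ℤ/Lℤ)^{d₁+d₂}` restricted to the second block is the lattice momentum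
of the second block. [cite: FriedliVelenikSMLS2017, §10.5.2 (10.41)] -/
theorem latticeMomentum_comp_natAdd {L : ℕ} (r : TorusSite (d₁ + d₂) L) :
    latticeMomentum L (fun j => r (Fin.natAdd d₁ j)) = fun j => latticeMomentum L r (Fin.natAdd d₁ j) :=
  rfl

omit [CompleteSpace E] in
/-- **The iterated momentum average is one momentum average in dimension `d₁ + d₂`**:
`L^{-d₁} Σ_p L^{-d₂} Σ_q G(2πp/L, 2πq/L) = L^{-(d₁+d₂)} Σ_r G((2πr/L)_I, (2πr/L)_II)`.
[cite: FriedliVelenikSMLS2017, §10.5.2 (10.41)] -/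
theorem momentumAverage_momentumAverage_eq {L : ℕ} [NeZero L]
    (G : (Fin d₁ → ℝ) → (Fin d₂ → ℝ) → E) :
    ((L ^ d₁ : ℕ) : ℝ)⁻¹ • ∑ p : TorusSite d₁ L, ((L ^ d₂ : ℕ) : ℝ)⁻¹ •
        ∑ q : TorusSite d₂ L, G (latticeMomentum L p) (latticeMomentum L q) =
      ((L ^ (d₁ + d₂) : ℕ) : ℝ)⁻¹ • ∑ r : TorusSite (d₁ + d₂) L,
        G (fun i => latticeMomentum L r (Fin.castAdd d₂ i)) (fun j => latticeMomentum L r (Fin.natAdd d₁ j)) := by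
  rw [← Finset.smul_sum, smul_smul,
    sum_sum_eq_sum_torusSite_add (fun p q => G (latticeMomentum L p) (latticeMomentum L q))]
  congr 1
  push_cast
  rw [pow_add, mul_inv]

/-! ### Two-loop momentum averages converge along all sides, uniformly in a compact parameter -/

/-- **Iterated momentum averages converge, all sides, uniformly in a compact parameter.** For
`G(x, y, z)` jointly continuous on `[0,2π]^{d₁} × [0,2π]^{d₂} × C` (`C` compact) and `ε > 0` there is
`L₀` such that for every side `L ≥ L₀` and every `z ∈ C`,
`‖L^{-d₁} Σ_p L^{-d₂} Σ_q G(2πp/L, 2πq/L, z) - (2π)^{-(d₁+d₂)} ∫_{[-π,π]^{d₁+d₂}} G(w_I + π, w_II + π, z) dw‖ ≤ ε`.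
[cite: BenfattoGiulianiMastropietro2006, §2.1 (2.3)–(2.8)] -/
theorem doubleMomentumAverage_uniform_approx_allSides {C : Set Y} (hC : IsCompact C)
    {G : (Fin d₁ → ℝ) → (Fin d₂ → ℝ) → Y → E}
    (hG : ContinuousOn (fun q : ((Fin d₁ → ℝ) × (Fin d₂ → ℝ)) × Y => G q.1.1 q.1.2 q.2)
      (((Set.pi Set.univ fun _ : Fin d₁ => Set.Icc (0 : ℝ) (2 * π)) ×ˢ
        (Set.pi Set.univ fun _ : Fin d₂ => Set.Icc (0 : ℝ) (2 * π))) ×ˢ C))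
    {ε : ℝ} (hε : 0 < ε) :
    ∃ L₀ : ℕ, ∀ (L : ℕ) [NeZero L], L₀ ≤ L → ∀ z ∈ C,
      ‖((L ^ d₁ : ℕ) : ℝ)⁻¹ • ∑ p : TorusSite d₁ L, ((L ^ d₂ : ℕ) : ℝ)⁻¹ •
            ∑ q : TorusSite d₂ L, G (latticeMomentum L p) (latticeMomentum L q) z -
          ((2 * π) ^ (d₁ + d₂))⁻¹ • ∫ w in brillouin (d₁ + d₂),
            G (fun i => w (Fin.castAdd d₂ i) + π) (fun j => w (Fin.natAdd d₁ j) + π) z‖ ≤ ε := by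
  -- the combined integrand on the `(d₁+d₂)`-cube
  set G' : (Fin (d₁ + d₂) → ℝ) → Y → E :=
    fun w z => G (fun i => w (Fin.castAdd d₂ i)) (fun j => w (Fin.natAdd d₁ j)) z with hG'
  have hsplit : Continuous fun w : Fin (d₁ + d₂) → ℝ =>
      ((fun i => w (Fin.castAdd d₂ i), fun j => w (Fin.natAdd d₁ j)) : (Fin d₁ → ℝ) × (Fin d₂ → ℝ)) :=
    (continuous_pi fun i => continuous_apply _).prodMk (continuous_pi fun j => continuous_apply _)
  have hmaps : ∀ w ∈ Set.pi Set.univ (fun _ : Fin (d₁ + d₂) => Set.Icc (0 : ℝ) (2 * π)),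
      ((fun i => w (Fin.castAdd d₂ i), fun j => w (Fin.natAdd d₁ j)) : (Fin d₁ → ℝ) × (Fin d₂ → ℝ)) ∈
        (Set.pi Set.univ fun _ : Fin d₁ => Set.Icc (0 : ℝ) (2 * π)) ×ˢ
          (Set.pi Set.univ fun _ : Fin d₂ => Set.Icc (0 : ℝ) (2 * π)) :=
    fun w hw => Set.mk_mem_prod (fun i _ => hw _ (Set.mem_univ _)) (fun j _ => hw _ (Set.mem_univ _))
  have hG'c : ContinuousOn (fun q : (Fin (d₁ + d₂) → ℝ) × Y => G' q.1 q.2)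
      ((Set.pi Set.univ fun _ : Fin (d₁ + d₂) => Set.Icc (0 : ℝ) (2 * π)) ×ˢ C) := by
    have h1 : ContinuousOn (fun q : (Fin (d₁ + d₂) → ℝ) × Y =>
        ((((fun i => q.1 (Fin.castAdd d₂ i), fun j => q.1 (Fin.natAdd d₁ j)) :
          (Fin d₁ → ℝ) × (Fin d₂ → ℝ)), q.2) : ((Fin d₁ → ℝ) × (Fin d₂ → ℝ)) × Y))
        ((Set.pi Set.univ fun _ : Fin (d₁ + d₂) => Set.Icc (0 : ℝ) (2 * π)) ×ˢ C) :=
      ((hsplit.comp continuous_fst).prodMk continuous_snd).continuousOn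
    refine hG.comp h1 fun q hq => ?_
    obtain ⟨hq1, hq2⟩ := Set.mem_prod.1 hq
    exact Set.mk_mem_prod (hmaps _ hq1) hq2
  obtain ⟨L₀, hL₀⟩ := momentumAverage_uniform_approx_allSides hC hG'c hε
  refine ⟨L₀, fun L _ hL z hz => ?_⟩
  have h := hL₀ L hL z hz
  rw [momentumAverage_momentumAverage_eq (fun x y => G x y z)]
  exact h

/-! ### Momentum conservation on the grid, modulo `2πℤ^d` -/

/-- The lattice momentum of the residue class of an integer vector `j` is `2πj/L` up to `2πℤ^d`:
`p_{[j]} = 2πj/L + 2πm`, `m_i = -⌊j_i/L⌋`. [cite: FriedliVelenikSMLS2017, §10.5.2 (10.41)] -/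
theorem exists_latticeMomentum_intCast_eq {L : ℕ} [NeZero L] (j : Fin d → ℤ) :
    ∃ m : Fin d → ℤ, latticeMomentum L (fun i => ((j i : ℤ) : ZMod L)) =
      fun i => 2 * π * (j i : ℝ) / L + 2 * π * (m i : ℝ) := by
  refine ⟨fun i => -(j i / (L : ℤ)), funext fun i => ?_⟩
  have hL : (L : ℝ) ≠ 0 := by exact_mod_cast NeZero.ne L
  have hval : ((((j i : ℤ) : ZMod L)).val : ℝ) = ((j i % (L : ℤ) : ℤ) : ℝ) := by
    rw [← ZMod.val_intCast (j i)]
    push_cast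
    rfl
  simp only [latticeMomentum]
  rw [hval, Int.emod_def]
  push_cast
  field_simp
  ring

/-- **Momentum conservation mod `2π`**: for torus sites `k, q, p ∈ (ℤ/Lℤ)^d`,
`p_{k + q - p} = p_k + p_q - p_p + 2πm` for some `m ∈ ℤ^d`.
[cite: FriedliVelenikSMLS2017, §10.5.2 (10.41)] -/
theorem exists_latticeMomentum_add_sub_eq {L : ℕ} [NeZero L] (k q p : TorusSite d L) :
    ∃ m : Fin d → ℤ, latticeMomentum L (k + q - p) =
      fun i => latticeMomentum L k i + latticeMomentum L q i - latticeMomentum L p i + 2 * π * (m i : ℝ) := by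
  have hL : (L : ℝ) ≠ 0 := by exact_mod_cast NeZero.ne L
  set j : Fin d → ℤ := fun i => ((k i).val : ℤ) + ((q i).val : ℤ) - ((p i).val : ℤ) with hj
  have hcast : (k + q - p) = fun i => ((j i : ℤ) : ZMod L) := by
    funext i
    simp only [hj, Pi.add_apply, Pi.sub_apply]
    push_cast
    rw [ZMod.natCast_zmod_val, ZMod.natCast_zmod_val, ZMod.natCast_zmod_val]
  obtain ⟨m, hm⟩ := exists_latticeMomentum_intCast_eq (L := L) j
  refine ⟨m, ?_⟩
  rw [hcast, hm]
  funext i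
  simp only [latticeMomentum, hj]
  push_cast
  field_simp

omit [NormedAddCommGroup E] [NormedSpace ℝ E] [CompleteSpace E] in
/-- A `2π`-periodic symbol evaluated at the conserved momentum: for `c` with
`c(x + 2πm) = c(x)` (`m ∈ ℤ^d`), `c(p_{k+q-p}) = c(p_k + p_q - p_p)`.
[cite: BenfattoGiulianiMastropietro2006, §2.1 (2.3)–(2.8)] -/
theorem apply_latticeMomentum_add_sub {L : ℕ} [NeZero L] {c : (Fin d → ℝ) → E}
    (hper : ∀ (x : Fin d → ℝ) (m : Fin d → ℤ), c (fun i => x i + 2 * π * (m i : ℝ)) = c x)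
    (k q p : TorusSite d L) :
    c (latticeMomentum L (k + q - p)) =
      c (fun i => latticeMomentum L k i + latticeMomentum L q i - latticeMomentum L p i) := by
  obtain ⟨m, hm⟩ := exists_latticeMomentum_add_sub_eq k q p
  rw [hm]
  exact hper _ m

end Literature.Probability.LatticeModels

end
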